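import Summits.ResolutionOfSingularities.ResolutionOfSingularities.Theorems.DeltaCutStellarCells
import Literature.AlgebraicGeometry.Resolution.MonomialMarkedIdealsBlowup
import Literature.AlgebraicGeometry.Resolution.MarkedIdealsArithmetic

/-!
# DeltaCutStellarTransform — ADDENDUM tree file 4 of the decomp-res lens-6 g32 node «StellarCut»: THE TRANSFORM LAW OF THE N.C.
# IDEAL SHAPE, list level (g33 window (1)(b) `idealShape_transform`; tool, 0-currency)

The ideal shape `𝓘 = Hⁿ + 𝓜`, `𝓜 = Π_j K_j^{a_j}` (`IsNCStage`, tree `DeltaCutStellar`), is typed here over the LITERATURE monomial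
vocabulary (`monomialIdeal E`, `boundaryOf E`, `weightOf E T`, `weightAt E x`, `HasSNC`, `transformExp`; Kollár (3.111) Step 3,
BGMW §4 Step 2b, files `MonomialMarkedIdeals`, `MonomialMarkedIdealsBlowup`): a contact divisor `H : X.IdealSheafData`, an exponent
list `E`, `HasSNC (H :: boundaryOf E)`, and a FACE centre `C = ∑_{K ∈ T} K` with `H ∈ T ⊆ H :: boundaryOf E` of weight
`∑_{K_j ∈ T} a_j ≥ n`. Proved (0 sorry), for `X` locally Noetherian and `π : X' → X` a blow-up along `C`:

* `comap_eq_strictTransformIdeal_mul_of_mem` / `comap_eq_strictTransformIdeal_of_not_mem` — the two divisor identities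
  `π^*K = K'·𝓘(F)` (`K ∈ T`) and `π^*K = K'` (`K ∉ T`) at SHEAF level (Literature has them on stalks);
* `controlledTransform_one_of_mem`, `controlledTransform_pow_of_mem` — `πᶜ(K, 1) = K'` and `πᶜ(Kⁿ, n) = K'ⁿ` for `K ∈ T`;
* `controlledTransform_ncShape` — THE TRANSFORM LAW: `πᶜ(Hⁿ + 𝓜, n) = H'ⁿ + 𝓘(F)^{w−n}·𝓜'` (`w = ∑_T a_j ≥ n`, `𝓜'` the monomial
  ideal of the strict transforms), i.e. `= H'ⁿ + monomialIdeal (transformExp E π T n)` (`controlledTransform_ncShape'`): the ideal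
  shape PERSISTS under face blow-ups, the exceptional divisor entering the monomial part with label `w − n` (BGMW `controlledTransform_sup`
  + `controlledTransform_pow` + `controlledTransform_monomialIdeal`, all Literature);
* `hasSNC_ncShape_transform` — the new frame `H' :: boundaryOf (transformExp E π T n)` has simple normal crossings (`hasSNC_transform`);
* `mem_support_ncShape_iff` (no s.n.c. needed) / `mem_support_ncShape_iff_weightAt` — THE LABEL RULE, list level:
  `supp(Hⁿ + 𝓜, n) = V(H) ∩ supp(𝓜, n) = V(H) ∩ {x | ∑_{K_j ∋ x} a_j ≥ n}` (`1 ≤ n`);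
* `support_finsetSup_subset_support_ncShape` + Literature `HasSNC.isRegular_subscheme_finsetSup` — a face of weight `≥ n` through `H`
  is a WEAKLY ADMISSIBLE centre; `weakAdmissible_cons_face` / `weakResolution_cons_face` — one STELLAR ROUND of a weak resolution
  (tree `WeakAdmissible` / `WeakResolution`), `transform_ideal_ncShape` — the round lands in the ideal shape again, and
  `support_ncShape_eq_empty` / `weakResolution_nil_of_support_eq_empty` — the terminal round (all labels through `H` below `n`).

What remains for `worNC_holds` (g33 (1)(c)) is ONLY the terminating face strategy (Kollár's measure on the faces through `H`) and the
bridge `IsNCStage` → this list data; neither is claimed here. [new] [folklore]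
-/

noncomputable section

open CategoryTheory CategoryTheory.Limits AlgebraicGeometry TopologicalSpace IsLocalRing
open Literature.AlgebraicGeometry.Resolution

namespace Summit.ResolutionOfSingularities.ResolutionOfSingularities.Theorems.DeltaCutClasses

universe u

/-! ### §DivisorLaws — the two divisor identities at sheaf level and the controlled transforms of a member of the face -/

section DivisorLaws

variable {X X' : Scheme.{u}} [IsLocallyNoetherian X] {π : X' ⟶ X} {Es : List X.IdealSheafData}
  {T : Finset X.IdealSheafData}

/-- **`π^*K = K' · 𝓘(F)` for a member `K` of the face `T`** (sheaf level; Literature `map_stalkIdeal_eq_mul_of_mem` on stalks).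
[cite: Kollar2007, (3.111) Step 3] -/
theorem comap_eq_strictTransformIdeal_mul_of_mem (hEs : HasSNC Es) (hT : ∀ K ∈ T, K ∈ Es)
    (hπ : IsBlowup π (T.sup id)) {K : X.IdealSheafData} (hK : K ∈ T) :
    K.comap π = strictTransformIdeal π (T.sup id) K * (T.sup id).comap π := by
  refine ext_of_forall_stalkIdeal_eq fun x' => ?_
  rw [stalkIdeal_comap_eq_map_stalkMap, stalkIdeal_mul]
  exact map_stalkIdeal_eq_mul_of_mem hEs hT hπ hK x'

/-- **`π^*K = K'` for a boundary member `K ∉ T`** (sheaf level; Literature `map_stalkIdeal_eq_of_not_mem` on stalks).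
[cite: Kollar2007, (3.111) Step 3] -/
theorem comap_eq_strictTransformIdeal_of_not_mem (hEs : HasSNC Es) (hT : ∀ K ∈ T, K ∈ Es)
    (hπ : IsBlowup π (T.sup id)) {K : X.IdealSheafData} (hKE : K ∈ Es) (hK : K ∉ T) :
    K.comap π = strictTransformIdeal π (T.sup id) K := by
  refine ext_of_forall_stalkIdeal_eq fun x' => ?_
  rw [stalkIdeal_comap_eq_map_stalkMap]
  exact map_stalkIdeal_eq_of_not_mem hEs hT hπ hKE hK x'

/-- **`πᶜ(K, 1) = K'`**: the controlled transform with control `1` of a member of the face is its strict transform. [folklore] -/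
theorem controlledTransform_one_of_mem (hEs : HasSNC Es) (hT : ∀ K ∈ T, K ∈ Es)
    (hπ : IsBlowup π (T.sup id)) {K : X.IdealSheafData} (hK : K ∈ T) :
    controlledTransform π (T.sup id) K 1 = strictTransformIdeal π (T.sup id) K := by
  haveI : IsProper π := hπ.isProper
  haveI : IsLocallyNoetherian X' := LocallyOfFiniteType.isLocallyNoetherian π
  rw [controlledTransform, comap_eq_strictTransformIdeal_mul_of_mem hEs hT hπ hK, mul_comm]
  simpa only [pow_one] using
    colon_pow_mul_eq hπ.isEffectiveCartier (strictTransformIdeal π (T.sup id) K) 1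

/-- **`πᶜ(Kⁿ, n) = K'ⁿ`** for a member `K` of the face. [folklore] -/
theorem controlledTransform_pow_of_mem (hEs : HasSNC Es) (hT : ∀ K ∈ T, K ∈ Es)
    (hπ : IsBlowup π (T.sup id)) {K : X.IdealSheafData} (hK : K ∈ T) (n : ℕ) :
    controlledTransform π (T.sup id) (K ^ n) n = strictTransformIdeal π (T.sup id) K ^ n := by
  haveI : IsProper π := hπ.isProper
  haveI : IsLocallyNoetherian X' := LocallyOfFiniteType.isLocallyNoetherian π
  have h1 : K.comap π ≤ (T.sup id).comap π ^ 1 := by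
    rw [pow_one]
    exact Scheme.IdealSheafData.comap_mono π (Finset.le_sup (f := id) hK)
  have h := controlledTransform_pow hπ.isEffectiveCartier h1 n
  rw [mul_one] at h
  rw [h, controlledTransform_one_of_mem hEs hT hπ hK]

end DivisorLaws

/-! ### §ShapeLaw — the transform law of the ideal shape `Hⁿ + 𝓜` along a face through `H` of weight `≥ n` -/

section ShapeLaw

variable {X X' : Scheme.{u}} {π : X' ⟶ X} {H : X.IdealSheafData}
  {E : List (X.IdealSheafData × ℕ)} {T : Finset X.IdealSheafData} {n : ℕ}

/-- the extended exponent list `(H, 0) :: E` has the same monomial ideal. [folklore] -/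
theorem monomialIdeal_cons_zero : monomialIdeal ((H, 0) :: E) = monomialIdeal E := by
  rw [monomialIdeal_cons, pow_zero, one_mul]

/-- … and the same weights on faces. [folklore] -/
theorem weightOf_cons_zero : weightOf ((H, 0) :: E) T = weightOf E T := by
  rw [weightOf_cons]
  split_ifs <;> simp

/-- … and the same weights at points. [folklore] -/
theorem weightAt_cons_zero (x : X) : weightAt ((H, 0) :: E) x = weightAt E x := by
  rw [weightAt_cons]
  split_ifs <;> simp

/-- … and the same supports at every marking. [folklore] -/
theorem support_monomialMarked_cons_zero (m : ℕ) :
    (monomialMarked ((H, 0) :: E) m).support = (monomialMarked E m).support := by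
  ext x
  simp only [MarkedIdeal.mem_support_iff, monomialMarked_ideal, monomialMarked_mult, monomialIdeal_cons_zero]

variable [IsLocallyNoetherian X]

/-- **THE TRANSFORM LAW OF THE IDEAL SHAPE** (g33 window (1)(b), list level): for `HasSNC (H :: boundaryOf E)`, a face
`C = ∑_{K∈T} K` with `H ∈ T ⊆ H :: boundaryOf E` of weight `w = ∑_{K_j ∈ T} a_j ≥ n`, and a blow-up `π` along `C` with exceptional
ideal `𝓘(F) = π^*C`:  `πᶜ(Hⁿ + Π K_j^{a_j}, n) = H'ⁿ + 𝓘(F)^{w − n} · Π (K_j')^{a_j}`.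
[cite: BierstoneGrigorievMilmanWlodarczyk2011, Lemma 3.7.1] [cite: Kollar2007, (3.111) Step 3] -/
theorem controlledTransform_ncShape (hEs : HasSNC (H :: boundaryOf E)) (hT : ∀ K ∈ T, K ∈ H :: boundaryOf E)
    (hHT : H ∈ T) (hπ : IsBlowup π (T.sup id)) (hn : n ≤ weightOf E T) :
    controlledTransform π (T.sup id) (H ^ n + monomialIdeal E) n =
      strictTransformIdeal π (T.sup id) H ^ n +
        (T.sup id).comap π ^ (weightOf E T - n) *
          monomialIdeal (E.map fun p => (strictTransformIdeal π (T.sup id) p.1, p.2)) := by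
  haveI : IsProper π := hπ.isProper
  haveI : IsLocallyNoetherian X' := LocallyOfFiniteType.isLocallyNoetherian π
  have hE' : HasSNC (boundaryOf ((H, 0) :: E)) := hEs
  have hT' : ∀ K ∈ T, K ∈ boundaryOf ((H, 0) :: E) := hT
  have hn' : n ≤ weightOf ((H, 0) :: E) T := by rwa [weightOf_cons_zero]
  have hHle : H.comap π ≤ (T.sup id).comap π :=
    Scheme.IdealSheafData.comap_mono π (Finset.le_sup (f := id) hHT)
  have hI : (H ^ n).comap π ≤ (T.sup id).comap π ^ n := by
    rw [comap_pow]
    exact pow_le_pow_left' hHle n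
  have hJ : (monomialIdeal E).comap π ≤ (T.sup id).comap π ^ n := by
    have h := (monomialMarked ((H, 0) :: E) n).comap_ideal_le_pow
      (support_finsetSup_subset_support_monomialMarked hE' hn') (hE'.hasSNCWith_finsetSup T hT') π
    simpa only [monomialMarked_ideal, monomialMarked_mult, monomialIdeal_cons_zero] using h
  rw [Scheme.IdealSheafData.add_eq_sup, Scheme.IdealSheafData.add_eq_sup,
    controlledTransform_sup hπ.isEffectiveCartier hI hJ, controlledTransform_pow_of_mem hEs hT hπ hHT n,
    ← monomialIdeal_cons_zero (H := H), controlledTransform_monomialIdeal hE' hT' hπ hn', weightOf_cons_zero,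
    List.map_cons, monomialIdeal_cons]
  simp only [pow_zero, one_mul]

/-- **THE TRANSFORM LAW, `transformExp` form**: `πᶜ(Hⁿ + 𝓜(E), n) = H'ⁿ + 𝓜(transformExp E π T n)` — the exceptional divisor joins the
monomial part with label `w − n`. [cite: Kollar2007, (3.111) Step 3] -/
theorem controlledTransform_ncShape' (hEs : HasSNC (H :: boundaryOf E)) (hT : ∀ K ∈ T, K ∈ H :: boundaryOf E)
    (hHT : H ∈ T) (hπ : IsBlowup π (T.sup id)) (hn : n ≤ weightOf E T) :
    controlledTransform π (T.sup id) (H ^ n + monomialIdeal E) n =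
      strictTransformIdeal π (T.sup id) H ^ n + monomialIdeal (transformExp E π T n) := by
  rw [controlledTransform_ncShape hEs hT hHT hπ hn, transformExp, monomialIdeal_append, monomialIdeal_singleton,
    mul_comm]

/-- **THE NEW FRAME HAS SIMPLE NORMAL CROSSINGS**: `HasSNC (H' :: boundaryOf (transformExp E π T n))`.
[cite: Kollar2007, Def. 3.25] -/
theorem hasSNC_ncShape_transform (hEs : HasSNC (H :: boundaryOf E)) (hT : ∀ K ∈ T, K ∈ H :: boundaryOf E)
    (hπ : IsBlowup π (T.sup id)) (m : ℕ) :
    HasSNC (strictTransformIdeal π (T.sup id) H :: boundaryOf (transformExp E π T m)) := by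
  have h := (hEs.hasSNCWith_finsetSup T hT).hasSNC_transform hπ
  rwa [List.map_cons, List.cons_append, ← boundaryOf_transformExp (E := E) m] at h

/-- **ONE ROUND LANDS IN THE IDEAL SHAPE AGAIN** (marked-ideal level, tree `MarkedIdeal.transform`): for an `n`-marked ideal
`M = (Hⁿ + 𝓜(E), _, n)`, `M' := M.transform π C` has ideal `H'ⁿ + 𝓜(transformExp E π T n)` and marking `n`. [folklore] -/
theorem transform_ideal_ncShape (hEs : HasSNC (H :: boundaryOf E)) (hT : ∀ K ∈ T, K ∈ H :: boundaryOf E)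
    (hHT : H ∈ T) (hπ : IsBlowup π (T.sup id)) (hn : n ≤ weightOf E T) (M : MarkedIdeal X)
    (hI : M.ideal = H ^ n + monomialIdeal E) (hμ : M.mult = n) :
    (M.transform π (T.sup id)).ideal = strictTransformIdeal π (T.sup id) H ^ n + monomialIdeal (transformExp E π T n) ∧
      (M.transform π (T.sup id)).mult = n := by
  refine ⟨?_, hμ⟩
  show controlledTransform π (T.sup id) M.ideal M.mult = _
  rw [hI, hμ]
  exact controlledTransform_ncShape' hEs hT hHT hπ hn

end ShapeLaw

/-! ### §SupportLaw — the label rule at list level and the weak admissibility of faces -/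

section SupportLaw

variable {X : Scheme.{u}} {H : X.IdealSheafData} {E : List (X.IdealSheafData × ℕ)} {T : Finset X.IdealSheafData} {n : ℕ}

/-- **`supp(Hⁿ + 𝓜, n) = V(H) ∩ supp(𝓜, n)`** for `1 ≤ n` (no s.n.c. needed: `(Hⁿ + 𝓜)_x ⊆ 𝔪ⁿ` iff `H_x ⊆ 𝔪` and `𝓜_x ⊆ 𝔪ⁿ`).
[folklore] -/
theorem mem_support_ncShape_iff (hn : 1 ≤ n) (M : MarkedIdeal X) (hI : M.ideal = H ^ n + monomialIdeal E)
    (hμ : M.mult = n) (x : X) :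
    x ∈ M.support ↔ x ∈ H.support ∧ x ∈ (monomialMarked E n).support := by
  rw [MarkedIdeal.mem_support_iff, MarkedIdeal.mem_support_iff, hI, hμ, monomialMarked_ideal, monomialMarked_mult,
    Scheme.IdealSheafData.add_eq_sup, stalkIdeal_sup, sup_le_iff, stalkIdeal_pow, mem_support_iff_stalkIdeal_le]
  constructor
  · rintro ⟨hH, hM⟩
    refine ⟨?_, hM⟩
    by_contra hle
    have htop : stalkIdeal H x = ⊤ := by
      by_contra hne
      exact hle (IsLocalRing.le_maximalIdeal hne)
    rw [htop, Ideal.top_pow] at hH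
    exact (IsLocalRing.maximalIdeal.isMaximal (X.presheaf.stalk x)).ne_top
      (top_le_iff.mp (hH.trans (Ideal.pow_le_self (by omega))))
  · rintro ⟨hH, hM⟩
    exact ⟨Ideal.pow_right_mono hH n, hM⟩

/-- **THE LABEL RULE, list level**: with an s.n.c. boundary, `x ∈ supp(Hⁿ + 𝓜, n) ↔ x ∈ V(H) ∧ ∑_{K_j ∋ x} a_j ≥ n` (`1 ≤ n`).
[cite: BierstoneGrigorievMilmanWlodarczyk2011, §4 Step 2b] -/
theorem mem_support_ncShape_iff_weightAt (hE : HasSNC (boundaryOf E)) (hn : 1 ≤ n) (M : MarkedIdeal X)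
    (hI : M.ideal = H ^ n + monomialIdeal E) (hμ : M.mult = n) (x : X) :
    x ∈ M.support ↔ x ∈ H.support ∧ n ≤ weightAt E x := by
  rw [mem_support_ncShape_iff hn M hI hμ, mem_support_monomialMarked_iff hE]

/-- the boundary part of an s.n.c. frame `H :: boundaryOf E` is s.n.c. [folklore] -/
theorem hasSNC_boundaryOf_of_cons (hEs : HasSNC (H :: boundaryOf E)) : HasSNC (boundaryOf E) :=
  HasSNCWith.sublist (List.sublist_cons_self H (boundaryOf E)) hEs

/-- **THE TERMINAL ROUND**: if every point of `V(H)` has boundary weight `< n`, the support is empty. [folklore] -/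
theorem support_ncShape_eq_empty (hE : HasSNC (boundaryOf E)) (hn : 1 ≤ n) (M : MarkedIdeal X)
    (hI : M.ideal = H ^ n + monomialIdeal E) (hμ : M.mult = n) (h : ∀ x ∈ H.support, weightAt E x < n) :
    M.support = ∅ := by
  ext x
  simp only [Set.mem_empty_iff_false, iff_false]
  intro hx
  obtain ⟨hxH, hw⟩ := (mem_support_ncShape_iff_weightAt hE hn M hI hμ x).mp hx
  exact absurd (h x hxH) (not_lt.mpr hw)

/-- **A FACE THROUGH `H` OF WEIGHT `≥ n` LIES IN THE SUPPORT** (first clause of weak admissibility; the second, regularity of the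
face, is Literature `HasSNC.isRegular_subscheme_finsetSup`). [cite: Kollar2007, (3.111) Step 3] -/
theorem support_finsetSup_subset_support_ncShape (hEs : HasSNC (H :: boundaryOf E))
    (hHT : H ∈ T) (hn1 : 1 ≤ n) (hn : n ≤ weightOf E T)
    (M : MarkedIdeal X) (hI : M.ideal = H ^ n + monomialIdeal E) (hμ : M.mult = n) :
    ((T.sup id).support : Set X) ⊆ M.support := by
  intro x hx
  rw [mem_support_ncShape_iff hn1 M hI hμ]
  have hE' : HasSNC (boundaryOf ((H, 0) :: E)) := hEs
  have hn' : n ≤ weightOf ((H, 0) :: E) T := by rwa [weightOf_cons_zero]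
  refine ⟨(mem_support_finsetSup_iff T x).mp hx H hHT, ?_⟩
  rw [← support_monomialMarked_cons_zero (H := H)]
  exact support_finsetSup_subset_support_monomialMarked hE' hn' hx

end SupportLaw

/-! ### §Round — one stellar round of a weak resolution (tree `WeakAdmissible` / `WeakResolution`, universe 0) -/

section Round

open Summit.ResolutionOfSingularities.ResolutionOfSingularities.Theorems.WeakOrderReduction

variable {X : Scheme.{0}} [IsLocallyNoetherian X] {H : X.IdealSheafData} {E : List (X.IdealSheafData × ℕ)}
  {T : Finset X.IdealSheafData} {n : ℕ}

omit [IsLocallyNoetherian X] in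
/-- **THE EMPTY SEQUENCE RESOLVES A MARKED IDEAL OF EMPTY SUPPORT.** [folklore] -/
theorem weakResolution_nil_of_support_eq_empty (M : MarkedIdeal X) (h : M.support = ∅) :
    WeakResolution (.nil X) M :=
  ⟨trivial, h⟩

/-- **ONE STELLAR ROUND, admissibility**: blowing up a face through `H` of weight `≥ n` and continuing weakly admissibly is weakly
admissible. [cite: BierstoneGrigorievMilmanWlodarczyk2011, Def. 3.1.3] -/
theorem weakAdmissible_cons_face (hEs : HasSNC (H :: boundaryOf E)) (hT : ∀ K ∈ T, K ∈ H :: boundaryOf E)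
    (hHT : H ∈ T) (hn1 : 1 ≤ n) (hn : n ≤ weightOf E T) (M : MarkedIdeal X)
    (hI : M.ideal = H ^ n + monomialIdeal E) (hμ : M.mult = n) {rest : CentreSeq (blowup (T.sup id))}
    (hrest : WeakAdmissible rest (M.transform (blowup.π (T.sup id)) (T.sup id))) :
    WeakAdmissible (.cons (T.sup id) rest) M :=
  ⟨support_finsetSup_subset_support_ncShape hEs hHT hn1 hn M hI hμ, hEs.isRegular_subscheme_finsetSup T hT, hrest⟩

/-- **ONE STELLAR ROUND, resolution**: if the rest weakly resolves the transform, the whole sequence weakly resolves `M`.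
[cite: BierstoneGrigorievMilmanWlodarczyk2011, Def. 3.1.3] -/
theorem weakResolution_cons_face (hEs : HasSNC (H :: boundaryOf E)) (hT : ∀ K ∈ T, K ∈ H :: boundaryOf E)
    (hHT : H ∈ T) (hn1 : 1 ≤ n) (hn : n ≤ weightOf E T) (M : MarkedIdeal X)
    (hI : M.ideal = H ^ n + monomialIdeal E) (hμ : M.mult = n) {rest : CentreSeq (blowup (T.sup id))}
    (hrest : WeakResolution rest (M.transform (blowup.π (T.sup id)) (T.sup id))) :
    WeakResolution (.cons (T.sup id) rest) M :=
  ⟨weakAdmissible_cons_face hEs hT hHT hn1 hn M hI hμ hrest.1, hrest.2⟩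

/-- **THE ROUND'S OUTPUT DATA** (induction step of the g33 face strategy): after the face blow-up the transform is again of ideal
shape `H'ⁿ + 𝓜(E')` with `E' = transformExp E π T n`, marking `n`, and s.n.c. frame `H' :: boundaryOf E'`. [folklore] -/
theorem ncShape_round (hEs : HasSNC (H :: boundaryOf E)) (hT : ∀ K ∈ T, K ∈ H :: boundaryOf E)
    (hHT : H ∈ T) (hn : n ≤ weightOf E T) (M : MarkedIdeal X)
    (hI : M.ideal = H ^ n + monomialIdeal E) (hμ : M.mult = n) :
    (M.transform (blowup.π (T.sup id)) (T.sup id)).ideal =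
        strictTransformIdeal (blowup.π (T.sup id)) (T.sup id) H ^ n +
          monomialIdeal (transformExp E (blowup.π (T.sup id)) T n) ∧
      (M.transform (blowup.π (T.sup id)) (T.sup id)).mult = n ∧
      HasSNC (strictTransformIdeal (blowup.π (T.sup id)) (T.sup id) H ::
        boundaryOf (transformExp E (blowup.π (T.sup id)) T n)) :=
  ⟨(transform_ideal_ncShape hEs hT hHT (blowup.isBlowup _) hn M hI hμ).1,
    (transform_ideal_ncShape hEs hT hHT (blowup.isBlowup _) hn M hI hμ).2,
    hasSNC_ncShape_transform hEs hT (blowup.isBlowup _) n⟩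

end Round

end Summit.ResolutionOfSingularities.ResolutionOfSingularities.Theorems.DeltaCutClasses
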